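import Literature.Computability.Complexity.MurrayWilliams2018Hierarchy
import HarnessLib

/-!
# Murray–Williams 2018, Theorem 1.2 for `AC⁰[m]`: witness circuits descend along clocks, and the simulation hypothesis at a single level

Companion of `MurrayWilliams2018Hierarchy.lean`, under the named fact
`Literature.Computability.Complexity.MurrayWilliams2018_NQP_not_subset_ACC0 : ¬ (NQP ⊆ ACC0)`
(`CircuitLowerBounds.lean`; C. D. Murray, R. R. Williams, *Circuit lower bounds for
nondeterministic quasi-polytime: an easy witness lemma for NP and NQP*, STOC 2018, Thm. 1.3 and
§1.1). That file proves the assembly of the source's Theorem 1.2 for `AC⁰[m]`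
(`MurrayWilliams2018_thm_1_2_acc_of_EWL_of_simulation`) over the tree's PROVED nondeterministic
time hierarchy theorem (`Diag.ntime_hierarchy_holds`, `DiagMachine.lean`) from two hypotheses:
`hEWL` (the easy witness lemma for `NQP`, Lemma 1.3, derived from `MurrayWilliams2018_lemma_4_1_ae`
in `MurrayWilliams2018Lemma13.lean`) and `hN`, the nondeterministic simulation `N` of §5 for a
binary language — which hands the simulation witness circuits for the verifiers of EVERY level
`T` dominating `g · (n + 2)ᵇ` (`∀ T, (∃ a, ∀ n, g n · (n+2)ᵇ ≤ a · T n + a) →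
HasWitnessCircuits T L (2^{(log₂ n)^K}) → …`).

The eventual discharge of `hN` builds ONE verifier for the hard language `L` — "the guessed
oracle `O` satisfies every local constraint of the circuit `C_x^O`" (§5, steps 1–3 of `N`; the
PCP proof `O` is the witness, p. 14: "the oracle `O` acts as a witness for the PCP verifier") —
of some fixed level `poly(g)`, and needs small witness circuits for THAT verifier. Under `hN` it
must therefore transport its verifier to foreign levels `T` and cut the witnesses back. This
file does that transport once, generically, and re-assembles Theorem 1.2 against the simulation
hypothesis asked at the single level `gᵇ` chosen by the simulation:

* **`HasWitnessCircuits.of_clocks`**, **`HasWitnessCircuits.of_timeConstructible`** — witness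
  circuits DESCEND from a level `t₂` to every time-constructible level `t₁ ≤ t₂ + O(1)`: a
  `t₁`-verifier is transported up along its unary clock (`NVerifier.exists_transport`,
  `MurrayWilliams2018Lemma13.lean`; `exists_unaryClock_of_timeConstructible`,
  `NTIMEHierarchyClock.lean`) and the small witnesses of the transported verifier, cut at the
  original admissible length, are small witnesses of the original one (the argument of
  `NTIMEHasWitnessCircuits.of_smoothQP`, made generic);
* **`MurrayWilliams2018_levelSimulation_of_simulation`** — the single-level simulation
  hypothesis (`hN` below) FOLLOWS from the every-level one of `MurrayWilliams2018Hierarchy.lean`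
  (take the level `T = g^{b+1}`), so it is the weaker hypothesis and every discharge of the
  latter discharges it;
* **`MurrayWilliams2018_thm_1_2_acc_of_EWL_of_levelSimulation`** — Theorem 1.2 for `AC⁰[m]`
  from `hEWL` and the single-level simulation hypothesis: the proof of
  `MurrayWilliams2018_thm_1_2_acc_of_EWL_of_simulation` (hard language from
  `exists_mem_NTIME_smoothQP_not_mem_smoothQPSim`, i.e. `Diag.ntime_hierarchy_holds` at
  `g = smoothQP E`, `f = smoothQPSim E`), with the witness circuits of the tree level
  `n ^ (log₂ n)^{max(e₀, E+1)}` brought down to the time-constructible level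
  `(smoothQP E)ᵇ ≤ n ^ (log₂ n)^{E+1}` (`isTimeConstructible_smoothQP_pow`,
  `eventually_smoothQP_pow_le_level`);
* **`MurrayWilliams2018_thm_1_2_acc_of_lemma_4_1_ae_of_levelSimulation`**,
  **`MurrayWilliams2018_NQP_not_ACC_of_lemma_4_1_ae_of_levelSimulation`**,
  **`MurrayWilliams2018_NQP_not_subset_ACC0_of_lemma_4_1_ae_of_levelSimulation`**,
  **`MurrayWilliams2018_NTIME_not_depth_ACC_of_lemma_4_1_ae_of_levelSimulation`** — the three
  Murray–Williams facts of `CircuitLowerBounds.lean` over the remaining unproved components: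
  `MurrayWilliams2018_lemma_4_1_ae` (named fact), the single-level simulation (inline
  hypothesis) and Williams' `ACC`-SAT algorithm `Williams2014_thm_4_1` (named fact; J. ACM 2014,
  Thm. 4.1, giving Thm. 5.1 by `MurrayWilliams2018_thm_5_1_of_thm_4_1`).

No notion, definition or named fact is introduced (theorems only).

## The single-level simulation hypothesis

It is the hypothesis `hN` of `MurrayWilliams2018Hierarchy.lean` (see the faithfulness notes
there and in `MurrayWilliams2018Transfer.lean`, which apply verbatim) with two changes, both
making it weaker (`MurrayWilliams2018_levelSimulation_of_simulation`): the simulation may also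
use that `g` is monotone (the source's `t(n) = 2^{log^a n}`; `smoothQP_mono`), and it receives
the witness circuits of size `2^{(log₂ n)^K}` for the verifiers of ONE level `n ↦ g(n)ᵇ`, `b ≥ 1`
of its choice, instead of for those of every level dominating `g · (n+2)ᵇ`. This is within the
printed argument: Lemma 1.3 gives witness circuits "for every `L ∈ NQP`" and every verifier
(§2: "`L` has witness circuits of size `w(n)` if every verifier for `L` has witnesses of size
`w(n)`"), in particular for the `poly(n) · T`-time PCP verifier of step 2 of `N` (p. 14), and
`gᵇ` is a quasi-polynomial level. With an exact deterministic SAT algorithm (`AccSatSubexp`, the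
setting of `MurrayWilliams2018_thm_1_2_acc`) the verifier of the discharge checks the `2^ℓ`,
`ℓ = log₂ T + O(log log T)`, local constraints of `C_x^O` against the guessed oracle: a verifier
of level `poly(g)`, which the discharge can lay out directly as a `gᵇ`-verifier.

## Trust base

Unchanged from `MurrayWilliams2018Hierarchy.lean`: the headline follows from
`{MurrayWilliams2018_lemma_4_1_ae, simulation of §5 (inline; here in the weaker single-level
form), Williams2014_thm_4_1}`.

## References

* C. D. Murray, R. R. Williams, *Circuit lower bounds for nondeterministic quasi-polytime: an
  easy witness lemma for NP and NQP*, STOC 2018, 890–901 (ECCC TR17-188), §2 (witness circuits),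
  Lemma 1.3, §5 (proofs of Thms. 1.1, 1.2: pp. 14–15), Thm. 5.1 [MurrayWilliams2018].
* S. Arora, B. Barak, *Computational Complexity: A Modern Approach*, CUP 2009, §2.1.2 and
  Thm. 2.6 (verifier form of `NTIME`), §1.3 (time-constructible functions), Thm. 3.2
  [AroraBarak2009].
* R. Williams, *Nonuniform ACC circuit lower bounds*, J. ACM 61 (2014), Thm. 4.1 [Williams2014].
-/

noncomputable section

namespace Literature.Computability.Complexity

open _root_.Computability Turing Filter Asymptotics Classes

/-! ### Witness circuits descend along clocks -/

/-- **Witness circuits descend along clocks.** If `L` has witness circuits of size `w` for its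
`t₂`-verifiers, and every admissible-length function `c · t₁ + c` (`c ≥ 1`) has a clock
`x ↦ ⟨x, 1^{c · t₁ |x| + c}⟩` running in time `a · t₂ |x| + a` with `c · t₁ + c ≤ a · t₂ + a` and
`n ≤ a · t₂ n + a`, then `L` has witness circuits of size `w` for its `t₁`-verifiers: a
`t₁`-verifier `V` is transported to the level `t₂` (`NVerifier.exists_transport`: relation
`V.rel x (y ↾ (c · t₁ |x| + c))`), the transported verifier has small witnesses on all long
`x ∈ L`, and cutting such a witness at `V`'s admissible length gives a witness for `V` that is
still a prefix of the same truth table (Murray–Williams 2018, §2: witness circuits are asked of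
every verifier; Arora–Barak 2009, Thm. 2.6: a verifier ignores the part of the certificate it
does not read). A `t₁`-verifier with constant `0` does not exist (`not_outputsWithin_zero`).
[cite: MurrayWilliams2018, §2 (Witness Circuits)] -/
theorem HasWitnessCircuits.of_clocks {t₁ t₂ : ℕ → ℕ} {L : Language Bool} {w : ℕ → ℕ}
    (h : HasWitnessCircuits t₂ L w)
    (hcl : ∀ c : ℕ, 1 ≤ c → ∃ (N : TM2ComputableAux Bool Bool) (a : ℕ),
      (∀ x : List Bool, N.OutputsWithin x
        (boolPair x (List.replicate (c * t₁ x.length + c) true)) (a * t₂ x.length + a)) ∧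
      (∀ n, c * t₁ n + c ≤ a * t₂ n + a) ∧ (∀ n, n ≤ a * t₂ n + a)) :
    HasWitnessCircuits t₁ L w := by
  intro V
  rcases Nat.eq_zero_or_pos V.c with hc | hc
  · have h0 := V.outputsWithin [] [] (by simp)
    rw [hc] at h0
    exact (not_outputsWithin_zero V.machine _ _ (by simpa using h0)).elim
  obtain ⟨N, a, hN, hw, hx⟩ := hcl V.c hc
  obtain ⟨V', hV'⟩ := V.exists_transport N a hN hw hx
  obtain ⟨n₀, hn₀⟩ := h V'
  refine ⟨n₀, fun x hxL hle => ?_⟩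
  obtain ⟨m, W, y, hW, hsz, -, hrel, hpre⟩ := hn₀ x hxL hle
  refine ⟨m, W, y.take (V.c * t₁ x.length + V.c), hW, hsz, List.length_take_le _ _, ?_,
    (List.take_prefix _ _).trans hpre⟩
  rw [← hV' x y]
  exact hrel

/-- **Witness circuits descend to time-constructible levels**: if `L` has witness circuits of size
`w` for its `t₂`-verifiers and `t₁` is time constructible with `t₁ ≤ t₂ + A`, then `L` has
witness circuits of size `w` for its `t₁`-verifiers (`HasWitnessCircuits.of_clocks` with the unary
clocks of the time-constructible functions `c · t₁ + c`, `exists_unaryClock_of_timeConstructible`,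
`IsTimeConstructible.mul_add`). [cite: MurrayWilliams2018, §2 (Witness Circuits)] -/
theorem HasWitnessCircuits.of_timeConstructible {t₁ t₂ : ℕ → ℕ} {L : Language Bool} {w : ℕ → ℕ}
    (h : HasWitnessCircuits t₂ L w) (ht₁ : IsTimeConstructible t₁) {A : ℕ}
    (hle : ∀ n, t₁ n ≤ t₂ n + A) : HasWitnessCircuits t₁ L w := by
  refine h.of_clocks fun c hc => ?_
  obtain ⟨N, a, hN⟩ := exists_unaryClock_of_timeConstructible (ht₁.mul_add hc)
  have hcA : A ≤ c * A := Nat.le_mul_of_pos_left A hc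
  refine ⟨N, a * c + (a * c * A + a * c + a) + (c * A + c) + 1, fun x => (hN x).mono ?_,
    fun n => ?_, fun n => ?_⟩
  · set n := x.length
    calc a * (c * t₁ n + c) + a ≤ a * (c * (t₂ n + A) + c) + a := by gcongr; exact hle n
      _ = (a * c) * t₂ n + (a * c * A + a * c + a) := by ring
      _ ≤ _ := Nat.add_le_add (Nat.mul_le_mul_right _ (by omega)) (by omega)
  · calc c * t₁ n + c ≤ c * (t₂ n + A) + c := by gcongr; exact hle n
      _ = c * t₂ n + (c * A + c) := by ring
      _ ≤ _ := Nat.add_le_add (Nat.mul_le_mul_right _ (by omega)) (by omega)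
  · calc n ≤ t₁ n := ht₁.1 n
      _ ≤ t₂ n + A := hle n
      _ ≤ _ := Nat.add_le_add (Nat.le_mul_of_pos_left _ (by omega)) (by omega)

/-- Powers of the smooth quasi-polynomial level stay below the next tree level: for every `b`,
eventually `(smoothQP E n)ᵇ ≤ n ^ (log₂ n)^{E+1}` (`b · qpExp E n ≤ 2b (log₂ n + 2)^{E+1} ≤
(log₂ n)^{E+2}` for large `n`, `eventually_mul_log_add_two_pow_le`; the computation inside
`NTIME_smoothQP_pow_subset`, `MurrayWilliams2018Lemma13.lean`, for every `b ≥ 0`). [folklore] -/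
theorem eventually_smoothQP_pow_le_level (E b : ℕ) :
    ∀ᶠ n in atTop, smoothQP E n ^ b ≤ n ^ Nat.log 2 n ^ (E + 1) := by
  filter_upwards [eventually_mul_log_add_two_pow_le (2 * b) (E + 1), eventually_ge_atTop 1]
    with n h1 h2
  set L := Nat.log 2 n with hL
  have hq : qpExp E n ≤ L + 1 + (L + 1) ^ (E + 1) := qpExp_le E n
  have h3 : b * qpExp E n ≤ L ^ (E + 1 + 1) := by
    have h5 : L + 1 ≤ (L + 2) ^ (E + 1) :=
      (Nat.le_succ _).trans (Nat.le_self_pow (by omega) _)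
    have h6 : (L + 1) ^ (E + 1) ≤ (L + 2) ^ (E + 1) := Nat.pow_le_pow_left (by omega) _
    calc b * qpExp E n ≤ b * (2 * (L + 2) ^ (E + 1)) := Nat.mul_le_mul_left b (by omega)
      _ = 2 * b * (L + 2) ^ (E + 1) := by ring
      _ ≤ L ^ (E + 1 + 1) := h1
  have hn2 : 2 ^ L ≤ n := Nat.pow_log_le_self 2 (by omega)
  calc smoothQP E n ^ b = 2 ^ (b * qpExp E n) := by rw [smoothQP, ← pow_mul, mul_comm]
    _ ≤ 2 ^ (L ^ (E + 1 + 1)) := Nat.pow_le_pow_right two_pos h3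
    _ = (2 ^ L) ^ (L ^ (E + 1)) := by rw [← pow_mul]; congr 1; ring
    _ ≤ n ^ (L ^ (E + 1)) := Nat.pow_le_pow_left hn2 _

/-! ### The single-level simulation hypothesis is weaker than the every-level one -/

/-- The level `g^{b+1}` dominates `g · (n + 2)ᵇ` when `g n ≥ n`:
`g n · (n+2)ᵇ ≤ a · g(n)^{b+1} + a` with `a = 3ᵇ + g(0) · 2ᵇ` (for `n ≥ 1`, `n + 2 ≤ 3 g(n)`).
[folklore] -/
theorem mul_add_two_pow_le_pow_succ {g : ℕ → ℕ} (hg : ∀ n, n ≤ g n) (b n : ℕ) :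
    g n * (n + 2) ^ b ≤ (3 ^ b + g 0 * 2 ^ b) * g n ^ (b + 1) + (3 ^ b + g 0 * 2 ^ b) := by
  rcases Nat.eq_zero_or_pos n with rfl | hn
  · calc g 0 * (0 + 2) ^ b = g 0 * 2 ^ b := by rw [zero_add]
      _ ≤ 3 ^ b + g 0 * 2 ^ b := Nat.le_add_left _ _
      _ ≤ _ := Nat.le_add_left _ _
  · have h3 : n + 2 ≤ 3 * g n := by have := hg n; omega
    calc g n * (n + 2) ^ b ≤ g n * (3 * g n) ^ b :=
          Nat.mul_le_mul_left _ (Nat.pow_le_pow_left h3 b)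
      _ = 3 ^ b * g n ^ (b + 1) := by rw [mul_pow, pow_succ]; ring
      _ ≤ (3 ^ b + g 0 * 2 ^ b) * g n ^ (b + 1) := Nat.mul_le_mul_right _ (Nat.le_add_right _ _)
      _ ≤ _ := Nat.le_add_right _ _

/-- **The single-level simulation hypothesis follows from the every-level one** (the hypothesis
`hN` of `MurrayWilliams2018_thm_1_2_acc_of_EWL_of_simulation`, `MurrayWilliams2018Hierarchy.lean`):
given witness circuits only for the verifiers of the level `g^{b+1}`, apply the every-level
simulation at `T = g^{b+1}`, which dominates `g · (n+2)ᵇ` (`mul_add_two_pow_le_pow_succ`); the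
savings inequality with exponent `b` follows from the one with exponent `b + 1` once
`log₂ g(n) ≥ 1`, which the growth hypothesis on `log₂ g` provides eventually. Hence the
single-level form is the WEAKER hypothesis. [cite: MurrayWilliams2018, Thm. 1.2 (proof, §5)] -/
theorem MurrayWilliams2018_levelSimulation_of_simulation
    (hN : ∃ c₀ : ℕ, ∀ (d m k K r : ℕ), 2 ≤ m → 1 ≤ k → 1 ≤ K → 2 ≤ r →
      AccSatSubexp (d + c₀) m r →
      (Classes.P ⊆ ⋃ a : ℕ,
          DepthSizeClass (accBasis m) (fun _ => d) (fun n => a * 2 ^ Nat.log 2 n ^ k + a)) →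
      ∀ g : ℕ → ℕ, PolyTimeComputable unaryEncodeNat encodeNat g → (∀ n, n ≤ g n) →
        (∀ c : ℕ, ∀ᶠ n in atTop, c * Nat.log 2 n ^ (k * K * r) ≤ Nat.log 2 (g n)) →
        ∃ b : ℕ, ∀ (T : ℕ → ℕ) (L : Language Bool), L ∈ NTIME g →
          (∃ a : ℕ, ∀ n, g n * (n + 2) ^ b ≤ a * T n + a) →
          HasWitnessCircuits T L (fun n => 2 ^ Nat.log 2 n ^ K) →
          ∀ f : ℕ → ℕ, (∀ n, n ≤ f n) →
            (∀ᶠ n in atTop,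
              g n * Nat.log 2 (g n) ^ b ≤ f n * 2 ^ Nat.nthRoot r (Nat.log 2 (g n))) →
            L ∈ NTIME f) :
    ∃ c₀ : ℕ, ∀ (d m k K r : ℕ), 2 ≤ m → 1 ≤ k → 1 ≤ K → 2 ≤ r →
      AccSatSubexp (d + c₀) m r →
      (Classes.P ⊆ ⋃ a : ℕ,
          DepthSizeClass (accBasis m) (fun _ => d) (fun n => a * 2 ^ Nat.log 2 n ^ k + a)) →
      ∀ g : ℕ → ℕ, PolyTimeComputable unaryEncodeNat encodeNat g → Monotone g →
        (∀ n, n ≤ g n) →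
        (∀ c : ℕ, ∀ᶠ n in atTop, c * Nat.log 2 n ^ (k * K * r) ≤ Nat.log 2 (g n)) →
        ∃ b : ℕ, 1 ≤ b ∧ ∀ L ∈ NTIME g,
          HasWitnessCircuits (fun n => g n ^ b) L (fun n => 2 ^ Nat.log 2 n ^ K) →
          ∀ f : ℕ → ℕ, (∀ n, n ≤ f n) →
            (∀ᶠ n in atTop,
              g n * Nat.log 2 (g n) ^ b ≤ f n * 2 ^ Nat.nthRoot r (Nat.log 2 (g n))) →
            L ∈ NTIME f := by
  obtain ⟨c₀, h⟩ := hN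
  refine ⟨c₀, fun d m k K r hm hk hK hr hS hP g hg _ hgn hlog => ?_⟩
  obtain ⟨b, hb⟩ := h d m k K r hm hk hK hr hS hP g hg hgn hlog
  refine ⟨b + 1, Nat.succ_pos b, fun L hL hw f hf hfg =>
    hb (fun n => g n ^ (b + 1)) L hL ⟨_, mul_add_two_pow_le_pow_succ hgn b⟩ hw f hf ?_⟩
  -- the savings inequality with exponent `b`, from the one with exponent `b + 1`
  have hlog1 : ∀ᶠ n in atTop, 1 ≤ Nat.log 2 (g n) := by
    filter_upwards [hlog 1, eventually_ge_atTop 2] with n h1 h2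
    have hl : 0 < Nat.log 2 n := Nat.log_pos one_lt_two h2
    calc 1 ≤ 1 * Nat.log 2 n ^ (k * K * r) := by rw [one_mul]; exact Nat.one_le_pow _ _ hl
      _ ≤ _ := h1
  filter_upwards [hfg, hlog1] with n h1 h2
  exact le_trans (Nat.mul_le_mul_left _ (Nat.pow_le_pow_right h2 (Nat.le_succ b))) h1

/-! ### Assembly: Theorem 1.2 for `AC⁰[m]` against the single-level simulation -/

/-- **Assembly of Murray–Williams' Theorem 1.2 (for `AC⁰[m]`) against the single-level
simulation hypothesis.** Hypotheses: `hEWL` — the easy witness lemma for `NQP` (Lemma 1.3) at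
the tree's levels, verbatim as in `MurrayWilliams2018_thm_1_2_acc_of_components`
(`MurrayWilliams2018Transfer.lean`; derived from `MurrayWilliams2018_lemma_4_1_ae` by
`MurrayWilliams2018_lemma_1_3_of_lemma_4_1_ae`); `hN` — the nondeterministic simulation of §5
for an arbitrary `L ∈ NTIME[g]` whose `gᵇ`-verifiers have witness circuits of size
`2^{(log₂ n)^K}` (module docstring). Conclusion: `MurrayWilliams2018_thm_1_2_acc`. Proof: that of
`MurrayWilliams2018_thm_1_2_acc_of_EWL_of_simulation` (§5, by contradiction from (A) "every
level `NTIME[n^{log^e n}]` has depth-`d`, `2^{log^k n}`-size `AC⁰[m]` circuits": unrestricted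
circuits of size `2^{log^{k+2} n}` a.e., witness circuits of size `2^{log^K n}` at all high levels,
the circuits of `P ⊆ NTIME[n^{log n}]`; `E = (k+1)Kr + 3r`, `g = smoothQP E`, `f = smoothQPSim E`;
the hard language `L ∈ NTIME[g] ∖ NTIME[f]` of `exists_mem_NTIME_smoothQP_not_mem_smoothQPSim`,
i.e. of the proved hierarchy theorem `Diag.ntime_hierarchy_holds`), except that the witness
circuits of the level `n^{log^{max(e₀, E+1)} n}` are brought down to the level `gᵇ`
(`HasWitnessCircuits.of_timeConstructible`, `isTimeConstructible_smoothQP_pow`,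
`eventually_smoothQP_pow_le_level`) before the simulation puts `L ∈ NTIME[f]` (savings
`g (log₂ g)ᵇ ≤ f · 2^{⌊(log₂ g)^{1/r}⌋}`, `eventually_smoothQP_mul_log_pow_le`) — "This is a
contradiction". [cite: MurrayWilliams2018, Thm. 1.2 (proof, §5)] -/
theorem MurrayWilliams2018_thm_1_2_acc_of_EWL_of_levelSimulation
    (hEWL : ∀ k : ℕ, 1 ≤ k →
      (∀ e : ℕ, 1 ≤ e → ∀ L ∈ NTIME (fun n => n ^ Nat.log 2 n ^ e),
          ∀ᶠ n in atTop, L.circuitSize n ≤ 2 ^ Nat.log 2 n ^ k) →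
        ∃ K e₀ : ℕ, 1 ≤ K ∧ ∀ e : ℕ, e₀ ≤ e →
          NTIMEHasWitnessCircuits (fun n => n ^ Nat.log 2 n ^ e) (fun n => 2 ^ Nat.log 2 n ^ K))
    (hN : ∃ c₀ : ℕ, ∀ (d m k K r : ℕ), 2 ≤ m → 1 ≤ k → 1 ≤ K → 2 ≤ r →
      AccSatSubexp (d + c₀) m r →
      (Classes.P ⊆ ⋃ a : ℕ,
          DepthSizeClass (accBasis m) (fun _ => d) (fun n => a * 2 ^ Nat.log 2 n ^ k + a)) →
      ∀ g : ℕ → ℕ, PolyTimeComputable unaryEncodeNat encodeNat g → Monotone g →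
        (∀ n, n ≤ g n) →
        (∀ c : ℕ, ∀ᶠ n in atTop, c * Nat.log 2 n ^ (k * K * r) ≤ Nat.log 2 (g n)) →
        ∃ b : ℕ, 1 ≤ b ∧ ∀ L ∈ NTIME g,
          HasWitnessCircuits (fun n => g n ^ b) L (fun n => 2 ^ Nat.log 2 n ^ K) →
          ∀ f : ℕ → ℕ, (∀ n, n ≤ f n) →
            (∀ᶠ n in atTop,
              g n * Nat.log 2 (g n) ^ b ≤ f n * 2 ^ Nat.nthRoot r (Nat.log 2 (g n))) →
            L ∈ NTIME f) :
    MurrayWilliams2018_thm_1_2_acc := by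
  intro d m hm hsat k
  by_contra hcon
  -- (A): every language of every level `e ≥ 1` has small depth-`d` `AC⁰[m]` circuits
  have hA : ∀ e : ℕ, 1 ≤ e → ∀ L ∈ NTIME (fun n => n ^ Nat.log 2 n ^ e), ∃ c : ℕ,
      L ∈ DepthSizeClass (accBasis m) (fun _ => d) (fun n => c * 2 ^ Nat.log 2 n ^ k + c) := by
    intro e he L hL
    by_contra h
    exact hcon ⟨e, he, L, hL, fun c hc => h ⟨c, hc⟩⟩
  obtain ⟨c₀, hN⟩ := hN
  obtain ⟨r, hr, hS⟩ := hsat (d + c₀)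
  -- (i) unrestricted circuits of size `2^{(log n)^{k+2}}` almost everywhere
  have hSIZE : ∀ e : ℕ, 1 ≤ e → ∀ L ∈ NTIME (fun n => n ^ Nat.log 2 n ^ e),
      ∀ᶠ n in atTop, L.circuitSize n ≤ 2 ^ Nat.log 2 n ^ (k + 2) := by
    intro e he L hL
    obtain ⟨c, hc⟩ := hA e he L hL
    exact eventually_circuitSize_le_of_mem_depthSizeClass hm hc
  -- (ii) witness circuits (Lemma 1.3 at exponent `k + 2`)
  obtain ⟨K, e₀, hK1, he₀⟩ := hEWL (k + 2) (by omega) hSIZE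
  -- (iii) `P` has the assumed circuits (exponent `k + 1 ≥ 1`)
  have hP : Classes.P ⊆ ⋃ a : ℕ,
      DepthSizeClass (accBasis m) (fun _ => d) (fun n => a * 2 ^ Nat.log 2 n ^ (k + 1) + a) := by
    intro L hL
    obtain ⟨c, hc⟩ := hA 1 le_rfl L (P_subset_NTIME_pow_log hL)
    exact Set.mem_iUnion.2 ⟨2 * c, DepthSizeClass_mono le_rfl (fun _ => le_rfl)
      (fun n => mul_two_pow_log_pow_le_succ c k n) hc⟩
  -- (iv) parameters and the hard language of the PROVED hierarchy theorem
  have hr1 : 1 ≤ r := by omega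
  obtain ⟨E, hE⟩ : ∃ E : ℕ, E = (k + 1) * K * r + 3 * r := ⟨_, rfl⟩
  have hE1 : 1 ≤ E := by omega
  have hE2 : 2 ≤ E := by omega
  obtain ⟨L, hLg, hLf⟩ := exists_mem_NTIME_smoothQP_not_mem_smoothQPSim hE2
  -- (v) the simulation puts `L` in `NTIME f`, `f = smoothQPSim E`
  obtain ⟨b, hb1, hb⟩ := hN d m (k + 1) K r hm (by omega) hK1 hr hS hP (smoothQP E)
    (polyTimeComputable_smoothQP E) (smoothQP_mono E) (le_smoothQP E)
    (fun c => eventually_mul_log_pow_le_log_smoothQP E c _ (by omega))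
  refine hLf (hb L hLg ?_ (smoothQPSim E) (le_smoothQPSim hE1) ?_)
  · -- witness circuits at the level `gᵇ`: from the tree level `max e₀ (E + 1)` along clocks
    have hw : HasWitnessCircuits (fun n => n ^ Nat.log 2 n ^ max e₀ (E + 1)) L
        (fun n => 2 ^ Nat.log 2 n ^ K) := (he₀ _ (le_max_left _ _)).hasWitnessCircuits L
    obtain ⟨A, hA'⟩ := exists_add_of_eventually_le (eventually_smoothQP_pow_le_level E b)
    refine hw.of_timeConstructible (isTimeConstructible_smoothQP_pow hE1 hb1) (A := A) fun n => ?_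
    exact (hA' n).trans (Nat.add_le_add_right (pow_log_pow_exp_mono (le_max_right _ _) n) _)
  · -- the savings inequality
    exact eventually_smoothQP_mul_log_pow_le hr1 (by omega) b

/-! ### Consequences over the remaining components -/

/-- **Murray–Williams' Theorem 1.2 for `AC⁰[m]` from Lemma 4.1 (a.e. form) and the single-level
simulation of §5** — the hierarchy step being the theorem `Diag.ntime_hierarchy_holds` and
Lemma 1.3 being `MurrayWilliams2018_lemma_1_3_of_lemma_4_1_ae`.
[cite: MurrayWilliams2018, Thm. 1.2 (proof, §5)] -/
theorem MurrayWilliams2018_thm_1_2_acc_of_lemma_4_1_ae_of_levelSimulation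
    (h41 : MurrayWilliams2018_lemma_4_1_ae)
    (hN : ∃ c₀ : ℕ, ∀ (d m k K r : ℕ), 2 ≤ m → 1 ≤ k → 1 ≤ K → 2 ≤ r →
      AccSatSubexp (d + c₀) m r →
      (Classes.P ⊆ ⋃ a : ℕ,
          DepthSizeClass (accBasis m) (fun _ => d) (fun n => a * 2 ^ Nat.log 2 n ^ k + a)) →
      ∀ g : ℕ → ℕ, PolyTimeComputable unaryEncodeNat encodeNat g → Monotone g →
        (∀ n, n ≤ g n) →
        (∀ c : ℕ, ∀ᶠ n in atTop, c * Nat.log 2 n ^ (k * K * r) ≤ Nat.log 2 (g n)) →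
        ∃ b : ℕ, 1 ≤ b ∧ ∀ L ∈ NTIME g,
          HasWitnessCircuits (fun n => g n ^ b) L (fun n => 2 ^ Nat.log 2 n ^ K) →
          ∀ f : ℕ → ℕ, (∀ n, n ≤ f n) →
            (∀ᶠ n in atTop,
              g n * Nat.log 2 (g n) ^ b ≤ f n * 2 ^ Nat.nthRoot r (Nat.log 2 (g n))) →
            L ∈ NTIME f) :
    MurrayWilliams2018_thm_1_2_acc :=
  MurrayWilliams2018_thm_1_2_acc_of_EWL_of_levelSimulation
    (MurrayWilliams2018_lemma_1_3_of_lemma_4_1_ae h41) hN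

/-- **`MurrayWilliams2018_NQP_not_ACC` over the remaining named components** — the Easy Witness
Lemma 4.1 (a.e. form, `MurrayWilliams2018_lemma_4_1_ae`), the single-level simulation of §5
(hypothesis `hN`) and Williams' `ACC`-SAT algorithm (`Williams2014_thm_4_1`, giving Thm. 5.1 by
`MurrayWilliams2018_thm_5_1_of_thm_4_1`) — the hierarchy theorem being proved.
[cite: MurrayWilliams2018, §1.1, Thm. 1.2, Thm. 5.1] -/
theorem MurrayWilliams2018_NQP_not_ACC_of_lemma_4_1_ae_of_levelSimulation
    (h41 : MurrayWilliams2018_lemma_4_1_ae)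
    (hN : ∃ c₀ : ℕ, ∀ (d m k K r : ℕ), 2 ≤ m → 1 ≤ k → 1 ≤ K → 2 ≤ r →
      AccSatSubexp (d + c₀) m r →
      (Classes.P ⊆ ⋃ a : ℕ,
          DepthSizeClass (accBasis m) (fun _ => d) (fun n => a * 2 ^ Nat.log 2 n ^ k + a)) →
      ∀ g : ℕ → ℕ, PolyTimeComputable unaryEncodeNat encodeNat g → Monotone g →
        (∀ n, n ≤ g n) →
        (∀ c : ℕ, ∀ᶠ n in atTop, c * Nat.log 2 n ^ (k * K * r) ≤ Nat.log 2 (g n)) →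
        ∃ b : ℕ, 1 ≤ b ∧ ∀ L ∈ NTIME g,
          HasWitnessCircuits (fun n => g n ^ b) L (fun n => 2 ^ Nat.log 2 n ^ K) →
          ∀ f : ℕ → ℕ, (∀ n, n ≤ f n) →
            (∀ᶠ n in atTop,
              g n * Nat.log 2 (g n) ^ b ≤ f n * 2 ^ Nat.nthRoot r (Nat.log 2 (g n))) →
            L ∈ NTIME f)
    (hW : Williams2014_thm_4_1) : MurrayWilliams2018_NQP_not_ACC :=
  MurrayWilliams2018_NQP_not_ACC_of_thm_1_2_acc
    (MurrayWilliams2018_thm_1_2_acc_of_lemma_4_1_ae_of_levelSimulation h41 hN)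
    (MurrayWilliams2018_thm_5_1_of_thm_4_1 hW)

/-- **The headline `¬ (NQP ⊆ ACC⁰)` (`MurrayWilliams2018_NQP_not_subset_ACC0`) over the remaining
named components** `MurrayWilliams2018_lemma_4_1_ae`, `Williams2014_thm_4_1` and the
single-level simulation of §5 (hypothesis `hN`), the hierarchy theorem being proved
(`Diag.ntime_hierarchy_holds`). [cite: MurrayWilliams2018, §1.1 and Thm. 1.3] -/
theorem MurrayWilliams2018_NQP_not_subset_ACC0_of_lemma_4_1_ae_of_levelSimulation
    (h41 : MurrayWilliams2018_lemma_4_1_ae)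
    (hN : ∃ c₀ : ℕ, ∀ (d m k K r : ℕ), 2 ≤ m → 1 ≤ k → 1 ≤ K → 2 ≤ r →
      AccSatSubexp (d + c₀) m r →
      (Classes.P ⊆ ⋃ a : ℕ,
          DepthSizeClass (accBasis m) (fun _ => d) (fun n => a * 2 ^ Nat.log 2 n ^ k + a)) →
      ∀ g : ℕ → ℕ, PolyTimeComputable unaryEncodeNat encodeNat g → Monotone g →
        (∀ n, n ≤ g n) →
        (∀ c : ℕ, ∀ᶠ n in atTop, c * Nat.log 2 n ^ (k * K * r) ≤ Nat.log 2 (g n)) →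
        ∃ b : ℕ, 1 ≤ b ∧ ∀ L ∈ NTIME g,
          HasWitnessCircuits (fun n => g n ^ b) L (fun n => 2 ^ Nat.log 2 n ^ K) →
          ∀ f : ℕ → ℕ, (∀ n, n ≤ f n) →
            (∀ᶠ n in atTop,
              g n * Nat.log 2 (g n) ^ b ≤ f n * 2 ^ Nat.nthRoot r (Nat.log 2 (g n))) →
            L ∈ NTIME f)
    (hW : Williams2014_thm_4_1) : MurrayWilliams2018_NQP_not_subset_ACC0 :=
  (MurrayWilliams2018_NQP_not_ACC_of_lemma_4_1_ae_of_levelSimulation h41 hN hW).not_subset_ACC0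

/-- **Theorem 1.3 (threshold-free form, `MurrayWilliams2018_NTIME_not_depth_ACC`) over the same
remaining components**, the hierarchy theorem being proved.
[cite: MurrayWilliams2018, Thm. 1.3] -/
theorem MurrayWilliams2018_NTIME_not_depth_ACC_of_lemma_4_1_ae_of_levelSimulation
    (h41 : MurrayWilliams2018_lemma_4_1_ae)
    (hN : ∃ c₀ : ℕ, ∀ (d m k K r : ℕ), 2 ≤ m → 1 ≤ k → 1 ≤ K → 2 ≤ r →
      AccSatSubexp (d + c₀) m r →
      (Classes.P ⊆ ⋃ a : ℕ,
          DepthSizeClass (accBasis m) (fun _ => d) (fun n => a * 2 ^ Nat.log 2 n ^ k + a)) →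
      ∀ g : ℕ → ℕ, PolyTimeComputable unaryEncodeNat encodeNat g → Monotone g →
        (∀ n, n ≤ g n) →
        (∀ c : ℕ, ∀ᶠ n in atTop, c * Nat.log 2 n ^ (k * K * r) ≤ Nat.log 2 (g n)) →
        ∃ b : ℕ, 1 ≤ b ∧ ∀ L ∈ NTIME g,
          HasWitnessCircuits (fun n => g n ^ b) L (fun n => 2 ^ Nat.log 2 n ^ K) →
          ∀ f : ℕ → ℕ, (∀ n, n ≤ f n) →
            (∀ᶠ n in atTop,
              g n * Nat.log 2 (g n) ^ b ≤ f n * 2 ^ Nat.nthRoot r (Nat.log 2 (g n))) →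
            L ∈ NTIME f)
    (hW : Williams2014_thm_4_1) : MurrayWilliams2018_NTIME_not_depth_ACC :=
  MurrayWilliams2018_NTIME_not_depth_ACC_of_thm_1_2_of_thm_4_1
    (MurrayWilliams2018_thm_1_2_acc_of_lemma_4_1_ae_of_levelSimulation h41 hN) hW

end Literature.Computability.Complexity

end
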